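import Summits.CriticalPhenomena.PercolationContinuityZ3.Theorems.PercNearOneGluingNoHeavyLowerTailSahiFreeSlotDensity
import HarnessLib

/-!
# `NoHeavyLowerTail` (stmt-CriticalPhenomena-4575) — the free-slot density is NONNEGATIVE on the full pattern, for every
# probability weight, by its CYCLE EXPANSION (orders 3, 4, 5)

Support file, seat `prim-l12-p5` (gen 19), `--supports stmt-CriticalPhenomena-4575`.  Standard axioms, no sorries, no named facts.

Gen 18's top-peeling theorem (`…SahiFreeSlotPeel`, `…SahiFreeSlotFourPeelTop`, memo FROM-prim-l12-p5-g18-TOP-PEELING) has two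
pattern-level hypotheses: `COND_TOP` and `z_O ≥ 0`, where `z_O` is the value of the free-slot density `Z_n(g)` (`SahiFreeSlot.zDen`,
`E_{n+1}(f; g) = E[f·Z_n(g)]`) at a point where every `g_j` equals `1` (a "full cell").  Gen 18 certified `z_O ≥ 0` for the 7- and
15-variable hitting parametrisations by a Bernstein recursion.  This file proves it for EVERY finite probability weight and every family
`0 ≤ g_j ≤ 1`, at orders 3, 4 and 5, by an identity that holds at every order (memo FROM-prim-l12-p5-g19-COND-TOP-TP2 §1):
`z_O = Σ_{σ ∈ Sym(n)} Π_{c cycle of σ} (1 − E[Π_{i∈c} g_i])` — the top value of the free-slot density is a sum over PERMUTATIONS of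
products of the nonnegative numbers `1 − E[g_c]` (exponential formula applied to `z_O = n! − Σ_{V ⊊ [n]} |V|!·E_{n−|V|}(g off V)`).
Here the identity is written out and checked by `ring` at `n = 2, 3, 4` (2, 6, 24 permutations) from the tree's closed forms
`zDen_two/three/four` and `sahiE_two/three/four`; nonnegativity follows factor by factor.
[this work; cite: LiebSahi2021, Def. 3.1 and Prop. 3.3; Sahi2008, eq. (7)]
-/

namespace Summit.CriticalPhenomena.PercolationContinuityZ3.Theorems

namespace SahiFreeSlot

open Finset Literature.Combinatorics.Sahi2008

variable {α : Type*} [Fintype α]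

/-! ### `1 − E[g_c] ≥ 0` for products of `[0,1]`-valued functions under a probability weight -/

/-- For a probability weight and `f ≤ 1` pointwise, `1 − E[f] ≥ 0`. [folklore] -/
theorem one_sub_ex_nonneg {μ : α → ℝ} (hμ : ∀ x, 0 ≤ μ x) (hμ1 : ∑ x, μ x = 1) {f : α → ℝ}
    (hf : ∀ x, f x ≤ 1) : 0 ≤ 1 - ex μ f := by
  have h : ex μ f ≤ ex μ (fun _ => (1 : ℝ)) := ex_mono hμ (fun x => hf x)
  have h1 : ex μ (fun _ => (1 : ℝ)) = 1 := by simp [ex, hμ1]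
  linarith

/-- If `0 ≤ a ≤ 1` and `b ≤ 1` then `a·b ≤ 1`. [folklore] -/
theorem mul_le_one_of_unit {a b : ℝ} (ha0 : 0 ≤ a) (ha : a ≤ 1) (hb : b ≤ 1) : a * b ≤ 1 := by
  nlinarith

/-! ### Order 3 (`n = 2`): `z_O = (1−E g₀)(1−E g₁) + (1 − E[g₀g₁])` -/

/-- Cycle expansion of the top value of `Z_2`: identity `(0)(1)` and the transposition `(01)`. [this work] -/
theorem zDen_two_top_eq (μ : α → ℝ) (g : Fin 2 → α → ℝ) (ω : α) (h0 : g 0 ω = 1) (h1 : g 1 ω = 1) :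
    zDen μ 2 g ω = (1 - ex μ (g 0)) * (1 - ex μ (g 1)) + (1 - ex μ (g 0 * g 1)) := by
  rw [zDen_two, sahiE_two_apply, h0, h1]
  ring

/-- **`z_O ≥ 0` at order 3** for every probability weight and `0 ≤ g_j ≤ 1`. [this work] -/
theorem zDen_two_top_nonneg {μ : α → ℝ} (hμ : ∀ x, 0 ≤ μ x) (hμ1 : ∑ x, μ x = 1) (g : Fin 2 → α → ℝ)
    (hg0 : ∀ j x, 0 ≤ g j x) (hg1 : ∀ j x, g j x ≤ 1) (ω : α) (htop : ∀ j, g j ω = 1) :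
    0 ≤ zDen μ 2 g ω := by
  rw [zDen_two_top_eq μ g ω (htop 0) (htop 1)]
  have a0 := one_sub_ex_nonneg hμ hμ1 (f := g 0) (fun x => hg1 0 x)
  have a1 := one_sub_ex_nonneg hμ hμ1 (f := g 1) (fun x => hg1 1 x)
  have a01 := one_sub_ex_nonneg hμ hμ1 (f := g 0 * g 1)
    (fun x => mul_le_one_of_unit (hg0 0 x) (hg1 0 x) (hg1 1 x))
  exact add_nonneg (mul_nonneg a0 a1) a01

/-! ### Order 4 (`n = 3`): the six permutations of `{0,1,2}` -/

/-- Cycle expansion of the top value of `Z_3`: `id`, three transpositions, two 3-cycles. [this work] -/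
theorem zDen_three_top_eq (μ : α → ℝ) (g : Fin 3 → α → ℝ) (ω : α)
    (h0 : g 0 ω = 1) (h1 : g 1 ω = 1) (h2 : g 2 ω = 1) :
    zDen μ 3 g ω =
      (1 - ex μ (g 0)) * (1 - ex μ (g 1)) * (1 - ex μ (g 2))
      + ((1 - ex μ (g 0 * g 1)) * (1 - ex μ (g 2)) + (1 - ex μ (g 0 * g 2)) * (1 - ex μ (g 1))
         + (1 - ex μ (g 1 * g 2)) * (1 - ex μ (g 0)))
      + 2 * (1 - ex μ (g 0 * g 1 * g 2)) := by
  rw [zDen_three, sahiE_three_apply, sahiE_two, sahiE_two, sahiE_two, h0, h1, h2]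
  ring

/-- **`z_O ≥ 0` at order 4** for every probability weight and `0 ≤ g_j ≤ 1`. [this work] -/
theorem zDen_three_top_nonneg {μ : α → ℝ} (hμ : ∀ x, 0 ≤ μ x) (hμ1 : ∑ x, μ x = 1) (g : Fin 3 → α → ℝ)
    (hg0 : ∀ j x, 0 ≤ g j x) (hg1 : ∀ j x, g j x ≤ 1) (ω : α) (htop : ∀ j, g j ω = 1) :
    0 ≤ zDen μ 3 g ω := by
  rw [zDen_three_top_eq μ g ω (htop 0) (htop 1) (htop 2)]
  have u1 : ∀ j x, g j x ≤ 1 := hg1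
  have p2 : ∀ i j x, g i x * g j x ≤ 1 := fun i j x =>
    mul_le_one_of_unit (hg0 i x) (hg1 i x) (hg1 j x)
  have p2n : ∀ i j x, 0 ≤ g i x * g j x := fun i j x => mul_nonneg (hg0 i x) (hg0 j x)
  have p3 : ∀ i j k x, g i x * g j x * g k x ≤ 1 := fun i j k x =>
    mul_le_one_of_unit (p2n i j x) (p2 i j x) (hg1 k x)
  have a0 := one_sub_ex_nonneg hμ hμ1 (f := g 0) (u1 0)
  have a1 := one_sub_ex_nonneg hμ hμ1 (f := g 1) (u1 1)
  have a2 := one_sub_ex_nonneg hμ hμ1 (f := g 2) (u1 2)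
  have a01 := one_sub_ex_nonneg hμ hμ1 (f := g 0 * g 1) (p2 0 1)
  have a02 := one_sub_ex_nonneg hμ hμ1 (f := g 0 * g 2) (p2 0 2)
  have a12 := one_sub_ex_nonneg hμ hμ1 (f := g 1 * g 2) (p2 1 2)
  have a012 := one_sub_ex_nonneg hμ hμ1 (f := g 0 * g 1 * g 2) (p3 0 1 2)
  have t1 : 0 ≤ (1 - ex μ (g 0)) * (1 - ex μ (g 1)) * (1 - ex μ (g 2)) := mul_nonneg (mul_nonneg a0 a1) a2
  have t2 : 0 ≤ (1 - ex μ (g 0 * g 1)) * (1 - ex μ (g 2)) := mul_nonneg a01 a2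
  have t3 : 0 ≤ (1 - ex μ (g 0 * g 2)) * (1 - ex μ (g 1)) := mul_nonneg a02 a1
  have t4 : 0 ≤ (1 - ex μ (g 1 * g 2)) * (1 - ex μ (g 0)) := mul_nonneg a12 a0
  positivity

/-! ### Order 5 (`n = 4`): the twenty-four permutations of `{0,1,2,3}` -/

/-- Cycle expansion of the top value of `Z_4` (the order-5 free-slot density): `id` (1), transpositions (6), double
transpositions (3), 3-cycles (8 = 2 per triple), 4-cycles (6). [this work] -/
theorem zDen_four_top_eq (μ : α → ℝ) (g : Fin 4 → α → ℝ) (ω : α)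
    (h0 : g 0 ω = 1) (h1 : g 1 ω = 1) (h2 : g 2 ω = 1) (h3 : g 3 ω = 1) :
    zDen μ 4 g ω =
      (1 - ex μ (g 0)) * (1 - ex μ (g 1)) * (1 - ex μ (g 2)) * (1 - ex μ (g 3))
      + ((1 - ex μ (g 0 * g 1)) * (1 - ex μ (g 2)) * (1 - ex μ (g 3))
         + (1 - ex μ (g 0 * g 2)) * (1 - ex μ (g 1)) * (1 - ex μ (g 3))
         + (1 - ex μ (g 0 * g 3)) * (1 - ex μ (g 1)) * (1 - ex μ (g 2))
         + (1 - ex μ (g 1 * g 2)) * (1 - ex μ (g 0)) * (1 - ex μ (g 3))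
         + (1 - ex μ (g 1 * g 3)) * (1 - ex μ (g 0)) * (1 - ex μ (g 2))
         + (1 - ex μ (g 2 * g 3)) * (1 - ex μ (g 0)) * (1 - ex μ (g 1)))
      + ((1 - ex μ (g 0 * g 1)) * (1 - ex μ (g 2 * g 3)) + (1 - ex μ (g 0 * g 2)) * (1 - ex μ (g 1 * g 3))
         + (1 - ex μ (g 0 * g 3)) * (1 - ex μ (g 1 * g 2)))
      + 2 * ((1 - ex μ (g 1 * g 2 * g 3)) * (1 - ex μ (g 0)) + (1 - ex μ (g 0 * g 2 * g 3)) * (1 - ex μ (g 1))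
         + (1 - ex μ (g 0 * g 1 * g 3)) * (1 - ex μ (g 2)) + (1 - ex μ (g 0 * g 1 * g 2)) * (1 - ex μ (g 3)))
      + 6 * (1 - ex μ (g 0 * g 1 * g 2 * g 3)) := by
  have hg : g = ![g 0, g 1, g 2, g 3] := by ext i x; fin_cases i <;> rfl
  rw [zDen_four]
  conv_lhs => rw [hg]
  simp only [sahiE_four, sahiE_three, sahiE_two, Matrix.cons_val_zero, Matrix.cons_val_one, Matrix.cons_val]
  rw [h0, h1, h2, h3]
  ring

/-- **`z_O ≥ 0` at order 5** (the hypothesis `z_O ≥ 0` of the top-peeling theorem at order 5), for every probability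
weight and `0 ≤ g_j ≤ 1`. [this work] -/
theorem zDen_four_top_nonneg {μ : α → ℝ} (hμ : ∀ x, 0 ≤ μ x) (hμ1 : ∑ x, μ x = 1) (g : Fin 4 → α → ℝ)
    (hg0 : ∀ j x, 0 ≤ g j x) (hg1 : ∀ j x, g j x ≤ 1) (ω : α) (htop : ∀ j, g j ω = 1) :
    0 ≤ zDen μ 4 g ω := by
  rw [zDen_four_top_eq μ g ω (htop 0) (htop 1) (htop 2) (htop 3)]
  have p2 : ∀ i j x, g i x * g j x ≤ 1 := fun i j x =>
    mul_le_one_of_unit (hg0 i x) (hg1 i x) (hg1 j x)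
  have p2n : ∀ i j x, 0 ≤ g i x * g j x := fun i j x => mul_nonneg (hg0 i x) (hg0 j x)
  have p3 : ∀ i j k x, g i x * g j x * g k x ≤ 1 := fun i j k x =>
    mul_le_one_of_unit (p2n i j x) (p2 i j x) (hg1 k x)
  have p3n : ∀ i j k x, 0 ≤ g i x * g j x * g k x := fun i j k x => mul_nonneg (p2n i j x) (hg0 k x)
  have p4 : ∀ i j k l x, g i x * g j x * g k x * g l x ≤ 1 := fun i j k l x =>
    mul_le_one_of_unit (p3n i j k x) (p3 i j k x) (hg1 l x)
  have a0 := one_sub_ex_nonneg hμ hμ1 (f := g 0) (hg1 0)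
  have a1 := one_sub_ex_nonneg hμ hμ1 (f := g 1) (hg1 1)
  have a2 := one_sub_ex_nonneg hμ hμ1 (f := g 2) (hg1 2)
  have a3 := one_sub_ex_nonneg hμ hμ1 (f := g 3) (hg1 3)
  have a01 := one_sub_ex_nonneg hμ hμ1 (f := g 0 * g 1) (p2 0 1)
  have a02 := one_sub_ex_nonneg hμ hμ1 (f := g 0 * g 2) (p2 0 2)
  have a03 := one_sub_ex_nonneg hμ hμ1 (f := g 0 * g 3) (p2 0 3)
  have a12 := one_sub_ex_nonneg hμ hμ1 (f := g 1 * g 2) (p2 1 2)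
  have a13 := one_sub_ex_nonneg hμ hμ1 (f := g 1 * g 3) (p2 1 3)
  have a23 := one_sub_ex_nonneg hμ hμ1 (f := g 2 * g 3) (p2 2 3)
  have a123 := one_sub_ex_nonneg hμ hμ1 (f := g 1 * g 2 * g 3) (p3 1 2 3)
  have a023 := one_sub_ex_nonneg hμ hμ1 (f := g 0 * g 2 * g 3) (p3 0 2 3)
  have a013 := one_sub_ex_nonneg hμ hμ1 (f := g 0 * g 1 * g 3) (p3 0 1 3)
  have a012 := one_sub_ex_nonneg hμ hμ1 (f := g 0 * g 1 * g 2) (p3 0 1 2)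
  have a0123 := one_sub_ex_nonneg hμ hμ1 (f := g 0 * g 1 * g 2 * g 3) (p4 0 1 2 3)
  have t0 : 0 ≤ (1 - ex μ (g 0)) * (1 - ex μ (g 1)) * (1 - ex μ (g 2)) * (1 - ex μ (g 3)) :=
    mul_nonneg (mul_nonneg (mul_nonneg a0 a1) a2) a3
  have t01 : 0 ≤ (1 - ex μ (g 0 * g 1)) * (1 - ex μ (g 2)) * (1 - ex μ (g 3)) := mul_nonneg (mul_nonneg a01 a2) a3
  have t02 : 0 ≤ (1 - ex μ (g 0 * g 2)) * (1 - ex μ (g 1)) * (1 - ex μ (g 3)) := mul_nonneg (mul_nonneg a02 a1) a3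
  have t03 : 0 ≤ (1 - ex μ (g 0 * g 3)) * (1 - ex μ (g 1)) * (1 - ex μ (g 2)) := mul_nonneg (mul_nonneg a03 a1) a2
  have t12 : 0 ≤ (1 - ex μ (g 1 * g 2)) * (1 - ex μ (g 0)) * (1 - ex μ (g 3)) := mul_nonneg (mul_nonneg a12 a0) a3
  have t13 : 0 ≤ (1 - ex μ (g 1 * g 3)) * (1 - ex μ (g 0)) * (1 - ex μ (g 2)) := mul_nonneg (mul_nonneg a13 a0) a2
  have t23 : 0 ≤ (1 - ex μ (g 2 * g 3)) * (1 - ex μ (g 0)) * (1 - ex μ (g 1)) := mul_nonneg (mul_nonneg a23 a0) a1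
  have d1 : 0 ≤ (1 - ex μ (g 0 * g 1)) * (1 - ex μ (g 2 * g 3)) := mul_nonneg a01 a23
  have d2 : 0 ≤ (1 - ex μ (g 0 * g 2)) * (1 - ex μ (g 1 * g 3)) := mul_nonneg a02 a13
  have d3 : 0 ≤ (1 - ex μ (g 0 * g 3)) * (1 - ex μ (g 1 * g 2)) := mul_nonneg a03 a12
  have c1 : 0 ≤ (1 - ex μ (g 1 * g 2 * g 3)) * (1 - ex μ (g 0)) := mul_nonneg a123 a0
  have c2 : 0 ≤ (1 - ex μ (g 0 * g 2 * g 3)) * (1 - ex μ (g 1)) := mul_nonneg a023 a1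
  have c3 : 0 ≤ (1 - ex μ (g 0 * g 1 * g 3)) * (1 - ex μ (g 2)) := mul_nonneg a013 a2
  have c4 : 0 ≤ (1 - ex μ (g 0 * g 1 * g 2)) * (1 - ex μ (g 3)) := mul_nonneg a012 a3
  positivity

end SahiFreeSlot

end Summit.CriticalPhenomena.PercolationContinuityZ3.Theorems
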